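import Mathlib
import HarnessLib

/-!
# Non-square descent — the two TOWER ENGINES of the line card `nonsquare-descent` (stubs S2/S3) for the seed crux
# `SignedMuSeedAtTwoPlus` stmt-BirchSwinnertonDyer-21438 (parent Kμ⁺ `SignedMuVanishingAtTwoPlus` stmt-BirchSwinnertonDyer-20689,
# route ResidualThetaTransportAtTwo)

Cell `bsd-wall`, width seat `bsd-wall-rtt-p4-w2` g17 (`--supports`, closes nothing).  THEOREMS ONLY; BSD is not proved by this and
nothing about units, class groups or elliptic units is asserted: both engines are statements about an abstract tower
`V 0 ← V 1 ← V 2 ← ⋯` of modules over a commutative ring `S` with «inclusions» `ι k : V k → V (k+1)` and «norms»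
`N k : V (k+1) → V k`.

§1 **Squares dichotomy** (stub S3; the engine of `Cruxes/SignedMuSeedAtTwoPlus/NonsquareDescentSketch.lean`, k2 g28, adapted and
generalised from the ladder `X^{2ⁿ}` over `R[X]` to any element `x : S` and any UNBOUNDED exponent ladder `d : ℕ → ℕ`):
if `ι` is injective, `ι k (N k v) = x^{d k} • v` and a norm-coherent family `u k ∈ V k` is killed by one fixed power `x^a` at
every level, then `u = 0` (`coherent_eq_zero_of_pow_smul_eq_zero`); contrapositive `exists_pow_smul_ne_zero_of_ne_zero` (ONE
`u m ≠ 0` ⇒ no power of `x` kills the family) and its discrete-valuation form `exists_smul_ne_zero_of_ne_zero` /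
`exists_smul_ne_zero_of_ne_zero_powerSeries` (over `k⟦X⟧`, `k` a field: ONE `u m ≠ 0` ⇒ NO non-zero power series kills the family,
i.e. the `Λ`-adic class `ū_∞` spans a FREE line — the card's «`ū_∞` is either `0` or free, detected at ANY ONE level»).
Dictionary: `S = 𝔽₄⟦X⟧ = Λ'/2`, `V k = 𝓔_k^χ/2`, `ι k` the inclusion (injective because `M_{k+1} = M_k(√α_k)` with `v_𝔓(α_k)` odd),
`N k` the norm, `= X^{2^k}` after inclusion in characteristic `2`, `u k = ū_k` the class of the Robert `χ`-unit.

§2 **Coherent invariants vanish** (stub S2, chain (2)–(4) of the card: «an `ω_n`-torsion coherent element is `2^{m'−m}`-divisible in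
the finite `B'_n`, hence `0`», so `Q'[ω_n] = 0` WITHOUT any local input): if `ι` is injective, `N k (ι k y) = c • y` (norm after
inclusion is multiplication by the index `c`), for `k ≥ n` every `ω`-torsion element of `V (k+1)` lies in the image of `ι k`, and
each `V k` is killed by some power of `c`, then every norm-coherent family `z` with `ω • z k = 0` for all `k` vanishes
(`exists_eq_pow_smul_of_coherent`, `coherent_torsion_eq_zero`); packaged for an inverse limit `Q` with jointly injective
compatible projections: `torsionBy_eq_bot_of_coherent` (**`Q[ω] = 0`**).  Dictionary: `S = Λ'`, `c = 2 = [M_{k+1} : M_k]`,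
`ω = ω_n`, `V k = B'_k = 𝓔_k^χ/𝒪[G_k]u_k` (finite, hence killed by a power of `2`), `ι k` / its image = the freeness descent
`B'_k ↪ B'_{k+1}` with image `(B'_{k+1})^{G_{k+1,k}} ⊇ (B'_{k+1})^{G_{k+1,n}}` (`k ≥ n`) of
`Theorems/…NonsquareDescentFreeness.lean` (`mapQ_injective_of_norm`, `range_mapQ_eq_torsionBy_of_norm`), `Q = Q' = lim B'_k`.

§0 is the bookkeeping lemma `exists_le_and_le_of_unbounded` (an unbounded `ℕ`-sequence is unbounded on every tail).  [folklore]
-/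

set_option autoImplicit false
-- the Theorems namespace of this sub repeats the summit name by design (D-0017 nested layout)
set_option linter.dupNamespace false

namespace Summit.BirchSwinnertonDyer.BirchSwinnertonDyer.Theorems.SignedMuAtTwo.NonsquareDescent

/-! ## §0 Unbounded exponent ladders -/

/-- An unbounded sequence of naturals is unbounded on every tail: if every `a` is `≤ d n` for some `n`, then for every
`a` and `n` there is `m ≥ n` with `a ≤ d m`. [folklore] -/
theorem exists_le_and_le_of_unbounded (d : ℕ → ℕ) (hd : ∀ a, ∃ n, a ≤ d n) (a n : ℕ) :
    ∃ m, n ≤ m ∧ a ≤ d m := by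
  obtain ⟨m, hm⟩ := hd (a + ∑ i ∈ Finset.range n, d i + 1)
  refine ⟨m, ?_, by omega⟩
  by_contra h
  push Not at h
  have hle : d m ≤ ∑ i ∈ Finset.range n, d i :=
    Finset.single_le_sum (f := d) (fun i _ => Nat.zero_le (d i)) (Finset.mem_range.mpr h)
  omega

section Tower

variable {S : Type*} [CommRing S]
variable (V : ℕ → Type*) [∀ n, AddCommGroup (V n)] [∀ n, Module S (V n)]

/-! ## §1 The squares dichotomy (stub S3 engine) -/

/-- **Squares dichotomy (abstract engine, any unbounded exponent ladder).**  In a tower of `S`-modules with injective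
transition maps `ι n : V n → V (n+1)` and norms `N n` satisfying `ι n (N n v) = x^{d n} • v` for an unbounded ladder `d`,
a norm-coherent family `u` is identically zero as soon as ONE fixed power `x^a` kills every `u n`.
(Levels with `a ≤ d n` die by injectivity of `ι n`: `ι n (u n) = x^{d n} • u (n+1) = x^{d n − a} • x^a • u (n+1) = 0`;
then descend with the norm relation.)  Adapted from `Cruxes/SignedMuSeedAtTwoPlus/NonsquareDescentSketch.lean`
(`squaresDichotomy`, ladder `2ⁿ` over `R[X]`). [folklore] -/
theorem coherent_eq_zero_of_pow_smul_eq_zero (x : S) (d : ℕ → ℕ) (hd : ∀ a, ∃ n, a ≤ d n)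
    (ι : ∀ n, V n →ₗ[S] V (n + 1)) (hι : ∀ n, Function.Injective (ι n))
    (N : ∀ n, V (n + 1) →ₗ[S] V n)
    (hN : ∀ n (v : V (n + 1)), ι n (N n v) = x ^ (d n) • v)
    (u : ∀ n, V n) (hu : ∀ n, N n (u (n + 1)) = u n)
    (a : ℕ) (ha : ∀ n, x ^ a • u n = 0) :
    ∀ n, u n = 0 := by
  have high : ∀ n, a ≤ d n → u n = 0 := by
    intro n hn
    apply hι n
    rw [map_zero, ← hu n, hN n]
    have hx : x ^ (d n) = x ^ (d n - a) * x ^ a := by rw [← pow_add, Nat.sub_add_cancel hn]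
    rw [hx, mul_smul, ha (n + 1), smul_zero]
  have step : ∀ n, u (n + 1) = 0 → u n = 0 := fun n h => by rw [← hu n, h, map_zero]
  have down : ∀ k n, u (n + k) = 0 → u n = 0 := by
    intro k
    induction k with
    | zero => intro n h; exact h
    | succ k ih => intro n h; exact ih n (step (n + k) h)
  intro n
  obtain ⟨m, hnm, ham⟩ := exists_le_and_le_of_unbounded d hd a n
  obtain ⟨k, rfl⟩ := Nat.exists_eq_add_of_le hnm
  exact down k n (high (n + k) ham)

/-- **The one-level certificate** (contrapositive of `coherent_eq_zero_of_pow_smul_eq_zero`): if some `u m ≠ 0` then NO power of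
`x` kills the whole coherent family — the card's «a non-square elliptic unit at ONE level certifies the `Λ`-adic statement».
[folklore] -/
theorem exists_pow_smul_ne_zero_of_ne_zero (x : S) (d : ℕ → ℕ) (hd : ∀ a, ∃ n, a ≤ d n)
    (ι : ∀ n, V n →ₗ[S] V (n + 1)) (hι : ∀ n, Function.Injective (ι n))
    (N : ∀ n, V (n + 1) →ₗ[S] V n)
    (hN : ∀ n (v : V (n + 1)), ι n (N n v) = x ^ (d n) • v)
    (u : ∀ n, V n) (hu : ∀ n, N n (u (n + 1)) = u n)
    {m : ℕ} (hm : u m ≠ 0) (a : ℕ) :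
    ∃ n, x ^ a • u n ≠ 0 := by
  by_contra h
  push Not at h
  exact hm (coherent_eq_zero_of_pow_smul_eq_zero V x d hd ι hι N hN u hu a h m)

/-- **Discrete-valuation form of the certificate**: if every non-zero `f : S` is `x^a · (unit)` (e.g. `S = k⟦X⟧`), then ONE
`u m ≠ 0` implies that NO non-zero `f` kills the coherent family — the `Λ`-adic class of `u` spans a free line («`ū_∞` is
either `0` or free»). [folklore] -/
theorem exists_smul_ne_zero_of_ne_zero (x : S)
    (hS : ∀ f : S, f ≠ 0 → ∃ (a : ℕ) (w : S), IsUnit w ∧ f = x ^ a * w)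
    (d : ℕ → ℕ) (hd : ∀ a, ∃ n, a ≤ d n)
    (ι : ∀ n, V n →ₗ[S] V (n + 1)) (hι : ∀ n, Function.Injective (ι n))
    (N : ∀ n, V (n + 1) →ₗ[S] V n)
    (hN : ∀ n (v : V (n + 1)), ι n (N n v) = x ^ (d n) • v)
    (u : ∀ n, V n) (hu : ∀ n, N n (u (n + 1)) = u n)
    {m : ℕ} (hm : u m ≠ 0) {f : S} (hf : f ≠ 0) :
    ∃ n, f • u n ≠ 0 := by
  obtain ⟨a, w, hw, rfl⟩ := hS f hf
  obtain ⟨n, hn⟩ := exists_pow_smul_ne_zero_of_ne_zero V x d hd ι hι N hN u hu hm a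
  refine ⟨n, fun h => hn ?_⟩
  rw [mul_comm, mul_smul, hw.smul_eq_zero] at h
  exact h

/-- Over `k⟦X⟧` (`k` a field) every non-zero power series is `X^{order} · (unit)` (Mathlib's `divXPowOrder`). [folklore] -/
theorem powerSeries_eq_X_pow_mul_unit {k : Type*} [Field k] (f : PowerSeries k) (hf : f ≠ 0) :
    ∃ (a : ℕ) (w : PowerSeries k), IsUnit w ∧ f = PowerSeries.X ^ a * w :=
  ⟨f.order.toNat, PowerSeries.divXPowOrder f, PowerSeries.isUnit_divided_by_X_pow_order hf,
    PowerSeries.X_pow_order_mul_divXPowOrder.symm⟩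

/-- **Squares dichotomy over `k⟦X⟧`** (the card's instance `S = 𝔽₄⟦X⟧`, `V n = 𝓔_n^χ/2`, `ι n` inclusion, `N n` norm
`= X^{2ⁿ}` in characteristic `2`, `u n = ū_n`): if ONE class `u m` is non-zero (GNS at one level) then no non-zero power
series kills the coherent family, i.e. `ū_∞` generates a FREE `k⟦X⟧`-line. [folklore] -/
theorem exists_smul_ne_zero_of_ne_zero_powerSeries {k : Type*} [Field k]
    (W : ℕ → Type*) [∀ n, AddCommGroup (W n)] [∀ n, Module (PowerSeries k) (W n)]
    (d : ℕ → ℕ) (hd : ∀ a, ∃ n, a ≤ d n)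
    (ι : ∀ n, W n →ₗ[PowerSeries k] W (n + 1)) (hι : ∀ n, Function.Injective (ι n))
    (N : ∀ n, W (n + 1) →ₗ[PowerSeries k] W n)
    (hN : ∀ n (v : W (n + 1)), ι n (N n v) = (PowerSeries.X : PowerSeries k) ^ (d n) • v)
    (u : ∀ n, W n) (hu : ∀ n, N n (u (n + 1)) = u n)
    {m : ℕ} (hm : u m ≠ 0) {f : PowerSeries k} (hf : f ≠ 0) :
    ∃ n, f • u n ≠ 0 :=
  exists_smul_ne_zero_of_ne_zero W PowerSeries.X powerSeries_eq_X_pow_mul_unit d hd ι hι N hN u hu hm hf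

/-! ## §2 Coherent invariants vanish (stub S2 engine): `Q'[ω_n] = 0` -/

/-- **Divisibility of coherent invariants.**  If `N k (ι k y) = c • y`, `ι` is injective and, from level `n` on, every
`ω`-torsion element of `V (k+1)` is in the image of `ι k`, then for a norm-coherent family `z` of `ω`-torsion elements and every
`e`, `z k` (`k ≥ n`) is `c^e` times an `ω`-torsion element: `z k = N^{(e)} z (k+e) = N^{(e)} ι^{(e)} y = c^e • y`. [folklore] -/
theorem exists_eq_pow_smul_of_coherent (c ω : S) (n : ℕ)
    (ι : ∀ k, V k →ₗ[S] V (k + 1)) (hι : ∀ k, Function.Injective (ι k))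
    (N : ∀ k, V (k + 1) →ₗ[S] V k) (hNι : ∀ k (y : V k), N k (ι k y) = c • y)
    (hinv : ∀ k, n ≤ k → ∀ z : V (k + 1), ω • z = 0 → z ∈ LinearMap.range (ι k))
    (z : ∀ k, V k) (hz : ∀ k, N k (z (k + 1)) = z k) (hω : ∀ k, ω • z k = 0)
    (e k : ℕ) (hk : n ≤ k) : ∃ y : V k, ω • y = 0 ∧ z k = c ^ e • y := by
  induction e generalizing k with
  | zero => exact ⟨z k, hω k, by rw [pow_zero, one_smul]⟩
  | succ e ih =>
      obtain ⟨y', hy'ω, hy'⟩ := ih (k + 1) (by omega)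
      obtain ⟨y, hy⟩ := hinv k hk y' hy'ω
      refine ⟨y, ?_, ?_⟩
      · apply hι k
        rw [map_smul, hy, hy'ω, map_zero]
      · rw [← hz k, hy', map_smul, ← hy, hNι, smul_smul, pow_succ]

/-- **Coherent `ω`-torsion families vanish** when, in addition, every level is killed by some power of the index `c`
(e.g. finite levels and `c = p`): the card's «an `ω_n`-torsion coherent element is `2^{m'−m}`-divisible in the finite `B'_n`,
hence `0`» — for ALL levels, the levels below `n` by descending with the norm. [folklore] -/
theorem coherent_torsion_eq_zero (c ω : S) (n : ℕ)
    (ι : ∀ k, V k →ₗ[S] V (k + 1)) (hι : ∀ k, Function.Injective (ι k))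
    (N : ∀ k, V (k + 1) →ₗ[S] V k) (hNι : ∀ k (y : V k), N k (ι k y) = c • y)
    (hinv : ∀ k, n ≤ k → ∀ z : V (k + 1), ω • z = 0 → z ∈ LinearMap.range (ι k))
    (htors : ∀ k, ∃ e : ℕ, ∀ y : V k, c ^ e • y = 0)
    (z : ∀ k, V k) (hz : ∀ k, N k (z (k + 1)) = z k) (hω : ∀ k, ω • z k = 0) :
    ∀ k, z k = 0 := by
  have hge : ∀ k, n ≤ k → z k = 0 := by
    intro k hk
    obtain ⟨e, he⟩ := htors k
    obtain ⟨y, -, hy⟩ := exists_eq_pow_smul_of_coherent V c ω n ι hι N hNι hinv z hz hω e k hk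
    rw [hy, he]
  have step : ∀ k, z (k + 1) = 0 → z k = 0 := fun k h => by rw [← hz k, h, map_zero]
  have down : ∀ j k, z (k + j) = 0 → z k = 0 := by
    intro j
    induction j with
    | zero => intro k h; exact h
    | succ j ih => intro k h; exact ih k (step (k + j) h)
  intro k
  exact down n k (hge (k + n) (by omega))

/-- **`Q[ω] = 0` for the inverse limit** (stub S2: `Q'[ω_n] = 0` for every `n`, whence the characteristic series of `Q'` is
prime to every `ω_n`): if `Q` carries compatible projections `π k : Q → V k` (`N k ∘ π (k+1) = π k`) which jointly detect `0`
(the inverse-limit property), then under the hypotheses of `coherent_torsion_eq_zero` the `ω`-torsion of `Q` is trivial.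
[folklore] -/
theorem torsionBy_eq_bot_of_coherent (c ω : S) (n : ℕ)
    (ι : ∀ k, V k →ₗ[S] V (k + 1)) (hι : ∀ k, Function.Injective (ι k))
    (N : ∀ k, V (k + 1) →ₗ[S] V k) (hNι : ∀ k (y : V k), N k (ι k y) = c • y)
    (hinv : ∀ k, n ≤ k → ∀ z : V (k + 1), ω • z = 0 → z ∈ LinearMap.range (ι k))
    (htors : ∀ k, ∃ e : ℕ, ∀ y : V k, c ^ e • y = 0)
    {Q : Type*} [AddCommGroup Q] [Module S Q] (π : ∀ k, Q →ₗ[S] V k)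
    (hπ : ∀ k (q : Q), N k (π (k + 1) q) = π k q) (hsep : ∀ q : Q, (∀ k, π k q = 0) → q = 0) :
    Submodule.torsionBy S Q ω = ⊥ := by
  rw [Submodule.eq_bot_iff]
  intro q hq
  rw [Submodule.mem_torsionBy_iff] at hq
  exact hsep q (coherent_torsion_eq_zero V c ω n ι hι N hNι hinv htors (fun k => π k q)
    (fun k => hπ k q) (fun k => by rw [← map_smul, hq, map_zero]))

end Tower

end Summit.BirchSwinnertonDyer.BirchSwinnertonDyer.Theorems.SignedMuAtTwo.NonsquareDescent
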